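import Summits.BirchSwinnertonDyer.Rank1Residual.GaloisImage.ThreeTorsionCubeRootWeilPairing
import HarnessLib

/-!
# Two Weil-type pairings on `E[3]` agree or are inverse to each other along any `E′[3] ≅ E[3]`
# (cell `b2b-bsdres`, team n1011, seat p02 gen 10 — row T-E3SYMP, file F3a; TOOL)

HONEST FRAMING (cell `b2b-bsdres`, run/shared/lean/b2b/bsd-rank1-residual/, verbatim in every
file): the goal of the cell is to DELETE the COMBINATION-SHAPED residual classes of the
Birch–Swinnerton-Dyer formula for ALL analytic-rank `≤ 1` elliptic curves over `ℚ` — "full BSD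
formula for every rank `≤ 1` curve in class `C`" assembled STRICTLY from published theorems — so
that the rank-`≤ 1` remainder becomes exactly the CONSTRUCTION-SHAPED classes, which are TYPED
(missing-input `Prop`s), NOT attempted. This is not "finishing BSD". Team n1011 (N10 / N11):
research route; no claim beyond the stated classes; labels UNCHANGED; nothing is booked. Theorems
only (no definition, no named fact).

## What this file proves

§1 (any abelian group `A`, any field `F`): for BILINEAR ALTERNATING pairings `f, g : A → A → F`
with non-zero values — antisymmetry `f T S = (f S T)⁻¹`, `f 0 T = 1`, `f (−S) T = (f S T)⁻¹`; if
`A` is exhausted by a basis `S₀, T₀` (`A = {0, ±S₀, ±T₀, ±(S₀+T₀), ±(S₀−T₀)}`, the shape of `E[3]`)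
then `f = g` as soon as `f S₀ T₀ = g S₀ T₀` (`eq_of_eq_at_basis`), and `f = g` or `f = g⁻¹` as soon
as `f S₀ T₀ = g S₀ T₀ ^ {±1}` (`eq_or_eq_inv_of_basis`); a NON-DEGENERATE `g` has `g S₀ T₀ ≠ 1`
(`ne_one_at_basis`); two primitive cube roots of unity are equal or inverse
(`eq_or_eq_inv_of_cube_eq_one`).

§2 (`E[3] = WeierstrassCurve.geomTorsion W 3`, `char K = 0`): `geomTorsion_three_eq_of_basis`
(exhaustion of `E[3]` by a basis, from file F2) and `exists_geomTorsion_three_basis` (a basis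
exists, `#E[3] = 9`); **`symplectic_or_antisymplectic`**: for elliptic curves `W, W′ / K`, Weil-type
pairings `e` on `E[3]` and `e′` on `E′[3]` (values with cube `1`, bilinear, alternating,
non-degenerate — e.g. ANY witnesses of the tree's `exists_weilPairing`, or the cube-root pairings
of file F2b) and ANY additive isomorphism `θ : E′[3] ≃+ E[3]`:
`(∀ S T, e (θ S) (θ T) = e′ S T) ∨ (∀ S T, e (θ S) (θ T) = (e′ S T)⁻¹)` — `θ` is SYMPLECTIC or
ANTI-SYMPLECTIC FOR THE GIVEN PAIRINGS `e, e′` (for `p = 3`, `Aut(μ₃) = {±1}`); which word applies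
depends on the chosen pair (replacing `e′` by `e′⁻¹` swaps them), and NO identification of any
particular `e` with the divisor-theoretic Weil pairing of `WeilPairingProofs` is claimed.  No Galois
action is involved here; file F3b reads the alternative off `Δ_E / Δ_{E′}` modulo cubes when `θ` is
`Γ_K`-equivariant and `e, e′` are the CUBE-ROOT pairings (normalisation (N) of file F2b).

References (context): Silverman *AEC* III.8; Fisher, Proc. LMS 104 (2012) §13 (symplectic /
anti-symplectic `3`-congruences); Freitas–Kraus, Mem. AMS 1361 (2022) (the symplectic type).
-/

noncomputable section

open scoped Classical

open WeierstrassCurve WeierstrassCurve.Affine.Point Literature.NumberTheory.EllipticCurves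

namespace Summit.BirchSwinnertonDyer.Rank1Residual.GaloisImage.CubeRootPairing

universe u

/-! ### §1. Bilinear alternating pairings on a group exhausted by a basis -/

section Pairings

variable {A : Type*} [AddCommGroup A] {F : Type*} [Field F] {f g : A → A → F}

/-- `f 0 T = 1` for a left-additive pairing with non-zero values. [folklore] -/
theorem pairing_zero_left (hl : ∀ S₁ S₂ T, f (S₁ + S₂) T = f S₁ T * f S₂ T)
    (hne : ∀ S T, f S T ≠ 0) (T : A) : f 0 T = 1 := by
  have h := hl 0 0 T
  rw [add_zero] at h
  exact (mul_eq_left₀ (hne 0 T)).mp h.symm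

/-- `f (−S) T = (f S T)⁻¹`. [folklore] -/
theorem pairing_neg_left (hl : ∀ S₁ S₂ T, f (S₁ + S₂) T = f S₁ T * f S₂ T)
    (hne : ∀ S T, f S T ≠ 0) (S T : A) : f (-S) T = (f S T)⁻¹ := by
  have h := hl S (-S) T
  rw [add_neg_cancel, pairing_zero_left hl hne] at h
  exact eq_inv_of_mul_eq_one_right h.symm

/-- `f S 0 = 1` for a right-additive pairing with non-zero values. [folklore] -/
theorem pairing_zero_right (hr : ∀ S T₁ T₂, f S (T₁ + T₂) = f S T₁ * f S T₂)
    (hne : ∀ S T, f S T ≠ 0) (S : A) : f S 0 = 1 := by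
  have h := hr S 0 0
  rw [add_zero] at h
  exact (mul_eq_left₀ (hne S 0)).mp h.symm

/-- `f S (−T) = (f S T)⁻¹`. [folklore] -/
theorem pairing_neg_right (hr : ∀ S T₁ T₂, f S (T₁ + T₂) = f S T₁ * f S T₂)
    (hne : ∀ S T, f S T ≠ 0) (S T : A) : f S (-T) = (f S T)⁻¹ := by
  have h := hr S T (-T)
  rw [add_neg_cancel, pairing_zero_right hr hne] at h
  exact eq_inv_of_mul_eq_one_right h.symm

/-- **Antisymmetry** of a bilinear alternating pairing: `f T S = (f S T)⁻¹`
(expand `f (S + T) (S + T) = 1`). [cite: SilvermanAEC2009, Prop. III.8.1 (b)] -/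
theorem pairing_swap (hl : ∀ S₁ S₂ T, f (S₁ + S₂) T = f S₁ T * f S₂ T)
    (hr : ∀ S T₁ T₂, f S (T₁ + T₂) = f S T₁ * f S T₂) (halt : ∀ T, f T T = 1)
    (S T : A) : f T S = (f S T)⁻¹ := by
  have h := halt (S + T)
  rw [hl, hr, hr, halt, halt, one_mul, mul_one] at h
  exact eq_inv_of_mul_eq_one_right h

/-- STEP A. If `f S₀ T₀ = g S₀ T₀` then `f S T₀ = g S T₀` for every `S` among the nine points of
the basis `S₀, T₀`. [folklore] -/
theorem eq_right_of_eq_at_basis (hfl : ∀ S₁ S₂ T, f (S₁ + S₂) T = f S₁ T * f S₂ T)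
    (hfalt : ∀ T, f T T = 1) (hfne : ∀ S T, f S T ≠ 0)
    (hgl : ∀ S₁ S₂ T, g (S₁ + S₂) T = g S₁ T * g S₂ T)
    (hgalt : ∀ T, g T T = 1) (hgne : ∀ S T, g S T ≠ 0) {S₀ T₀ : A} (h : f S₀ T₀ = g S₀ T₀) {S : A}
    (hS : S = 0 ∨ S = S₀ ∨ S = -S₀ ∨ S = T₀ ∨ S = -T₀ ∨ S = S₀ + T₀ ∨ S = -(S₀ + T₀) ∨
      S = S₀ - T₀ ∨ S = -(S₀ - T₀)) :
    f S T₀ = g S T₀ := by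
  have f0 := pairing_zero_left hfl hfne T₀
  have g0 := pairing_zero_left hgl hgne T₀
  have fn := pairing_neg_left hfl hfne
  have gn := pairing_neg_left hgl hgne
  rcases hS with rfl | rfl | rfl | rfl | rfl | rfl | rfl | rfl | rfl
  · rw [f0, g0]
  · exact h
  · rw [fn, gn, h]
  · rw [hfalt, hgalt]
  · rw [fn, gn, hfalt, hgalt]
  · rw [hfl, hgl, hfalt, hgalt, h]
  · rw [fn, gn, hfl, hgl, hfalt, hgalt, h]
  · rw [sub_eq_add_neg, hfl, hgl, fn, gn, hfalt, hgalt, h]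
  · rw [fn, gn, sub_eq_add_neg, hfl, hgl, fn, gn, hfalt, hgalt, h]

/-- **Two bilinear alternating pairings that agree at a basis agree everywhere** (the group being
exhausted by the basis). [folklore] -/
theorem eq_of_eq_at_basis (hfl : ∀ S₁ S₂ T, f (S₁ + S₂) T = f S₁ T * f S₂ T)
    (hfr : ∀ S T₁ T₂, f S (T₁ + T₂) = f S T₁ * f S T₂) (hfalt : ∀ T, f T T = 1)
    (hfne : ∀ S T, f S T ≠ 0)
    (hgl : ∀ S₁ S₂ T, g (S₁ + S₂) T = g S₁ T * g S₂ T)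
    (hgr : ∀ S T₁ T₂, g S (T₁ + T₂) = g S T₁ * g S T₂) (hgalt : ∀ T, g T T = 1)
    (hgne : ∀ S T, g S T ≠ 0) {S₀ T₀ : A}
    (hex : ∀ R : A, R = 0 ∨ R = S₀ ∨ R = -S₀ ∨ R = T₀ ∨ R = -T₀ ∨ R = S₀ + T₀ ∨ R = -(S₀ + T₀) ∨
      R = S₀ - T₀ ∨ R = -(S₀ - T₀))
    (h : f S₀ T₀ = g S₀ T₀) (S T : A) : f S T = g S T := by
  -- on the two lines through the basis vectors
  have hT₀ : ∀ S, f S T₀ = g S T₀ := fun S =>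
    eq_right_of_eq_at_basis hfl hfalt hfne hgl hgalt hgne h (hex S)
  have h' : f T₀ S₀ = g T₀ S₀ := by
    rw [pairing_swap hfl hfr hfalt, pairing_swap hgl hgr hgalt, h]
  have hS₀ : ∀ S, f S S₀ = g S S₀ := fun S => by
    refine eq_right_of_eq_at_basis hfl hfalt hfne hgl hgalt hgne h' ?_
    rcases hex S with e | e | e | e | e | e | e | e | e
    · exact Or.inl e
    · exact Or.inr (Or.inr (Or.inr (Or.inl e)))
    · exact Or.inr (Or.inr (Or.inr (Or.inr (Or.inl e))))
    · exact Or.inr (Or.inl e)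
    · exact Or.inr (Or.inr (Or.inl e))
    · exact Or.inr (Or.inr (Or.inr (Or.inr (Or.inr (Or.inl (by rw [e, add_comm]))))))
    · exact Or.inr (Or.inr (Or.inr (Or.inr (Or.inr (Or.inr (Or.inl (by rw [e, add_comm])))))))
    · exact Or.inr (Or.inr (Or.inr (Or.inr (Or.inr (Or.inr (Or.inr (Or.inr (by rw [e, neg_sub]))))))))
    · exact Or.inr (Or.inr (Or.inr (Or.inr (Or.inr (Or.inr (Or.inr (Or.inl (by rw [e, neg_sub]))))))))
  have fnr := pairing_neg_right hfr hfne
  have gnr := pairing_neg_right hgr hgne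
  rcases hex T with rfl | rfl | rfl | rfl | rfl | rfl | rfl | rfl | rfl
  · rw [pairing_zero_right hfr hfne, pairing_zero_right hgr hgne]
  · exact hS₀ S
  · rw [fnr, gnr, hS₀]
  · exact hT₀ S
  · rw [fnr, gnr, hT₀]
  · rw [hfr, hgr, hS₀, hT₀]
  · rw [fnr, gnr, hfr, hgr, hS₀, hT₀]
  · rw [sub_eq_add_neg, hfr, hgr, fnr, gnr, hS₀, hT₀]
  · rw [fnr, gnr, sub_eq_add_neg, hfr, hgr, fnr, gnr, hS₀, hT₀]

/-- **Agree-or-inverse at a basis propagates**: if `f S₀ T₀ = g S₀ T₀` then `f = g`; if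
`f S₀ T₀ = (g S₀ T₀)⁻¹` then `f = g⁻¹` pointwise. [folklore] -/
theorem eq_or_eq_inv_of_basis (hfl : ∀ S₁ S₂ T, f (S₁ + S₂) T = f S₁ T * f S₂ T)
    (hfr : ∀ S T₁ T₂, f S (T₁ + T₂) = f S T₁ * f S T₂) (hfalt : ∀ T, f T T = 1)
    (hfne : ∀ S T, f S T ≠ 0)
    (hgl : ∀ S₁ S₂ T, g (S₁ + S₂) T = g S₁ T * g S₂ T)
    (hgr : ∀ S T₁ T₂, g S (T₁ + T₂) = g S T₁ * g S T₂) (hgalt : ∀ T, g T T = 1)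
    (hgne : ∀ S T, g S T ≠ 0) {S₀ T₀ : A}
    (hex : ∀ R : A, R = 0 ∨ R = S₀ ∨ R = -S₀ ∨ R = T₀ ∨ R = -T₀ ∨ R = S₀ + T₀ ∨ R = -(S₀ + T₀) ∨
      R = S₀ - T₀ ∨ R = -(S₀ - T₀))
    (h : f S₀ T₀ = g S₀ T₀ ∨ f S₀ T₀ = (g S₀ T₀)⁻¹) :
    (∀ S T, f S T = g S T) ∨ (∀ S T, f S T = (g S T)⁻¹) := by
  rcases h with h | h
  · exact Or.inl (eq_of_eq_at_basis hfl hfr hfalt hfne hgl hgr hgalt hgne hex h)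
  · right
    refine eq_of_eq_at_basis (g := fun S T => (g S T)⁻¹) hfl hfr hfalt hfne
      (fun S₁ S₂ T => by rw [hgl, mul_inv]) (fun S T₁ T₂ => by rw [hgr, mul_inv])
      (fun T => by rw [hgalt, inv_one]) (fun S T => inv_ne_zero (hgne S T)) hex h

/-- **A non-degenerate pairing is `≠ 1` at a basis.** [folklore] -/
theorem ne_one_at_basis (hgl : ∀ S₁ S₂ T, g (S₁ + S₂) T = g S₁ T * g S₂ T)
    (hgalt : ∀ T, g T T = 1) (hgne : ∀ S T, g S T ≠ 0)
    (hgnd : ∀ T, (∀ S, g S T = 1) → T = 0) {S₀ T₀ : A}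
    (hex : ∀ R : A, R = 0 ∨ R = S₀ ∨ R = -S₀ ∨ R = T₀ ∨ R = -T₀ ∨ R = S₀ + T₀ ∨ R = -(S₀ + T₀) ∨
      R = S₀ - T₀ ∨ R = -(S₀ - T₀))
    (hT₀ : T₀ ≠ 0) : g S₀ T₀ ≠ 1 := by
  intro h1
  apply hT₀ (hgnd T₀ fun S => ?_)
  exact eq_right_of_eq_at_basis (g := fun _ _ => (1 : F)) hgl hgalt hgne
    (fun _ _ _ => (mul_one _).symm) (fun _ => rfl) (fun _ _ => one_ne_zero) h1 (hex S)

/-- Two cube roots of unity `≠ 1` in a field are equal or inverse to each other. [folklore] -/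
theorem eq_or_eq_inv_of_cube_eq_one {x y : F} (hx : x ^ 3 = 1) (hx1 : x ≠ 1) (hy : y ^ 3 = 1)
    (hy1 : y ≠ 1) : y = x ∨ y = x⁻¹ := by
  have hx0 : x ≠ 0 := fun h => by rw [h] at hx; norm_num at hx
  have qx : x ^ 2 + x + 1 = 0 := by
    have : (x - 1) * (x ^ 2 + x + 1) = 0 := by linear_combination hx
    exact (mul_eq_zero.mp this).resolve_left (sub_ne_zero.mpr hx1)
  have qy : y ^ 2 + y + 1 = 0 := by
    have : (y - 1) * (y ^ 2 + y + 1) = 0 := by linear_combination hy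
    exact (mul_eq_zero.mp this).resolve_left (sub_ne_zero.mpr hy1)
  have hinv : x⁻¹ = x ^ 2 := inv_eq_of_mul_eq_one_right (by rw [← pow_succ']; exact hx)
  have key : (y - x) * (y - x ^ 2) = 0 := by linear_combination qy - y * qx + hx
  rcases mul_eq_zero.mp key with h | h
  · exact Or.inl (sub_eq_zero.mp h)
  · exact Or.inr (by rw [hinv]; exact sub_eq_zero.mp h)


/-- **Constancy from moves.** On a group killed by `3` and exhausted by every basis, a function
`c` of bases (`P, Q, P + Q, P − Q ≠ 0`) invariant under the five moves `(P,Q) ↦ (Q,P)`, `(−P,Q)`,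
`(P,−Q)`, `(P,P+Q)`, `(P,P−Q)` is CONSTANT on bases (all partners of a fixed `P` are reached in
two moves, then swap). [folklore] -/
theorem const_of_moves {X : Type*} (c : A → A → X) (h3 : ∀ P : A, (3 : ℤ) • P = 0)
    (hex : ∀ P Q : A, P ≠ 0 → Q ≠ 0 → P + Q ≠ 0 → P - Q ≠ 0 → ∀ R : A,
      R = 0 ∨ R = P ∨ R = -P ∨ R = Q ∨ R = -Q ∨ R = P + Q ∨ R = -(P + Q) ∨
        R = P - Q ∨ R = -(P - Q))
    (I1 : ∀ P Q : A, P ≠ 0 → Q ≠ 0 → P + Q ≠ 0 → P - Q ≠ 0 → c Q P = c P Q)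
    (I2 : ∀ P Q : A, P ≠ 0 → Q ≠ 0 → P + Q ≠ 0 → P - Q ≠ 0 → c (-P) Q = c P Q)
    (I3 : ∀ P Q : A, P ≠ 0 → Q ≠ 0 → P + Q ≠ 0 → P - Q ≠ 0 → c P (-Q) = c P Q)
    (I4 : ∀ P Q : A, P ≠ 0 → Q ≠ 0 → P + Q ≠ 0 → P - Q ≠ 0 → c P (P + Q) = c P Q)
    (I5 : ∀ P Q : A, P ≠ 0 → Q ≠ 0 → P + Q ≠ 0 → P - Q ≠ 0 → c P (P - Q) = c P Q)
    {P Q P' Q' : A} (hP : P ≠ 0) (hQ : Q ≠ 0) (hPQ : P + Q ≠ 0) (hPQ' : P - Q ≠ 0)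
    (hP' : P' ≠ 0) (hQ' : Q' ≠ 0) (hP'Q' : P' + Q' ≠ 0) (hP'Q'' : P' - Q' ≠ 0) :
    c P' Q' = c P Q := by
  -- identities in a group killed by `3`
  have twice : ∀ P : A, P + P = -P := fun P => add_self_eq_neg_of_three_smul (h3 P)
  have e1 : ∀ P Q : A, P + (P + Q) = -(P - Q) := fun P Q => by
    rw [← add_assoc, twice]; abel
  have e2 : ∀ P Q : A, P + (P - Q) = -(P + Q) := fun P Q => by
    rw [sub_eq_add_neg, ← add_assoc, twice]; abel
  -- admissibility of the neighbouring bases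
  have admA : ∀ P Q : A, P ≠ 0 → Q ≠ 0 → P + Q ≠ 0 → P - Q ≠ 0 →
      P + (P + Q) ≠ 0 ∧ P - (P + Q) ≠ 0 ∧ P + (P - Q) ≠ 0 ∧ P - (P - Q) ≠ 0 ∧
        P + -Q ≠ 0 ∧ P - -Q ≠ 0 := fun P Q _ hQ hp hm =>
    ⟨by rw [e1, neg_ne_zero]; exact hm, by rw [sub_add_cancel_left, neg_ne_zero]; exact hQ,
      by rw [e2, neg_ne_zero]; exact hp, by rw [sub_sub_cancel]; exact hQ,
      by rw [← sub_eq_add_neg]; exact hm, by rw [sub_neg_eq_add]; exact hp⟩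
  -- STEP A: for fixed `P`, all partners give the same value
  have stepA : ∀ P Q Q' : A, P ≠ 0 → Q ≠ 0 → P + Q ≠ 0 → P - Q ≠ 0 → Q' ≠ 0 → P + Q' ≠ 0 →
      P - Q' ≠ 0 → c P Q' = c P Q := by
    intro P Q Q' hP hQ hp hm hQ' hp' hm'
    obtain ⟨a1, a2, a3, a4, -, -⟩ := admA P Q hP hQ hp hm
    rcases hex P Q hP hQ hp hm Q' with rfl | rfl | rfl | rfl | rfl | rfl | rfl | rfl | rfl
    · exact absurd rfl hQ'
    · exact absurd (sub_self _) hm'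
    · exact absurd (add_neg_cancel _) hp'
    · rfl
    · exact I3 P Q hP hQ hp hm
    · exact I4 P Q hP hQ hp hm
    · rw [I3 P (P + Q) hP hp a1 a2]; exact I4 P Q hP hQ hp hm
    · exact I5 P Q hP hQ hp hm
    · rw [I3 P (P - Q) hP hm a3 a4]; exact I5 P Q hP hQ hp hm
  -- STEP B: move the first vector
  obtain ⟨a1, a2, a3, a4, a5, a6⟩ := admA P Q hP hQ hPQ hPQ'
  have viaP' : P + P' ≠ 0 → P - P' ≠ 0 → c P' Q' = c P Q := fun hp hm => by
    have hba : P' + P ≠ 0 := by rwa [add_comm]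
    have hbs : P' - P ≠ 0 := by rw [← neg_sub, neg_ne_zero]; exact hm
    rw [stepA P' P Q' hP' hP hba hbs hQ' hP'Q' hP'Q'', ← I1 P' P hP' hP hba hbs,
      stepA P Q P' hP hQ hPQ hPQ' hP' hp hm]
  rcases hex P Q hP hQ hPQ hPQ' P' with rfl | rfl | rfl | rfl | rfl | rfl | rfl | rfl | rfl
  · exact absurd rfl hP'
  · exact stepA _ Q Q' hP hQ hPQ hPQ' hQ' hP'Q' hP'Q''
  · have hp : P + Q' ≠ 0 := by
      rw [show -P - Q' = -(P + Q') by abel, neg_ne_zero] at hP'Q''; exact hP'Q''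
    have hm : P - Q' ≠ 0 := by
      rw [show -P + Q' = -(P - Q') by abel, neg_ne_zero] at hP'Q'; exact hP'Q'
    rw [I2 P Q' hP hQ' hp hm]
    exact stepA P Q Q' hP hQ hPQ hPQ' hQ' hp hm
  · exact viaP' hPQ hPQ'
  · exact viaP' a5 a6
  · exact viaP' a1 a2
  · exact viaP' (by rw [← sub_eq_add_neg]; exact a2) (by rw [sub_neg_eq_add]; exact a1)
  · exact viaP' a3 a4
  · exact viaP' (by rw [← sub_eq_add_neg]; exact a4) (by rw [sub_neg_eq_add]; exact a3)

end Pairings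


/-! ### §2. `E[3]`: exhaustion by a basis, existence of a basis, the dichotomy -/

section Torsion

variable {K : Type u} [Field K] [CharZero K] (W : WeierstrassCurve K) [W.IsElliptic]

/-- **`E[3]` is exhausted by any basis** (`S₀, T₀, S₀ ± T₀ ≠ O`): every `R ∈ E[3]` is one of
`O, ±S₀, ±T₀, ±(S₀ + T₀), ±(S₀ − T₀)` (file F2, `eq_of_basis_of_three_smul`, read in the subgroup).
[cite: SilvermanAEC2009, Cor. III.6.4(b)] -/
theorem geomTorsion_three_eq_of_basis {S₀ T₀ : geomTorsion W 3} (h₁ : S₀ ≠ 0) (h₂ : T₀ ≠ 0)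
    (h₃ : S₀ + T₀ ≠ 0) (h₄ : S₀ - T₀ ≠ 0) (R : geomTorsion W 3) :
    R = 0 ∨ R = S₀ ∨ R = -S₀ ∨ R = T₀ ∨ R = -T₀ ∨ R = S₀ + T₀ ∨ R = -(S₀ + T₀) ∨
      R = S₀ - T₀ ∨ R = -(S₀ - T₀) := by
  have mem3 : ∀ P : geomTorsion W 3,
      (3 : ℤ) • (show (W.baseChange (AlgebraicClosure K)).toAffine.Point from (P : geomPoints W)) = 0 :=
    fun P => (Submodule.mem_torsionBy_iff _ _).mp P.2
  have ne : ∀ {P : geomTorsion W 3}, P ≠ 0 →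
      (show (W.baseChange (AlgebraicClosure K)).toAffine.Point from (P : geomPoints W)) ≠ 0 :=
    fun hP h => hP (Subtype.ext h)
  have h := eq_of_basis_of_three_smul (W := W.baseChange (AlgebraicClosure K))
    (S := show (W.baseChange (AlgebraicClosure K)).toAffine.Point from (S₀ : geomPoints W))
    (T := show (W.baseChange (AlgebraicClosure K)).toAffine.Point from (T₀ : geomPoints W))
    (mem3 S₀) (mem3 T₀) (ne h₁) (ne h₂) (ne h₃) (ne h₄) (mem3 R)
  rcases h with h | h | h | h | h | h | h | h | h
  · exact Or.inl (Subtype.ext h)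
  · exact Or.inr (Or.inl (Subtype.ext h))
  · exact Or.inr (Or.inr (Or.inl (Subtype.ext h)))
  · exact Or.inr (Or.inr (Or.inr (Or.inl (Subtype.ext h))))
  · exact Or.inr (Or.inr (Or.inr (Or.inr (Or.inl (Subtype.ext h)))))
  · exact Or.inr (Or.inr (Or.inr (Or.inr (Or.inr (Or.inl (Subtype.ext h))))))
  · exact Or.inr (Or.inr (Or.inr (Or.inr (Or.inr (Or.inr (Or.inl (Subtype.ext h)))))))
  · exact Or.inr (Or.inr (Or.inr (Or.inr (Or.inr (Or.inr (Or.inr (Or.inl (Subtype.ext h))))))))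
  · exact Or.inr (Or.inr (Or.inr (Or.inr (Or.inr (Or.inr (Or.inr (Or.inr (Subtype.ext h))))))))

/-- **`E[3]` has a basis**: there are `S₀, T₀ ∈ E[3]` with `S₀, T₀, S₀ + T₀, S₀ − T₀ ≠ O`
(`#E[3] = 9`). [cite: SilvermanAEC2009, Cor. III.6.4(b)] -/
theorem exists_geomTorsion_three_basis :
    ∃ S₀ T₀ : geomTorsion W 3, S₀ ≠ 0 ∧ T₀ ≠ 0 ∧ S₀ + T₀ ≠ 0 ∧ S₀ - T₀ ≠ 0 := by
  have h3 : ((3 : ℕ) : AlgebraicClosure K) ≠ 0 := by norm_num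
  have hcard : Nat.card (geomTorsion W (3 : ℤ)) = 3 ^ 2 :=
    card_torsionPoints_eq_sq_holds W (AlgebraicClosure K) (n := 3) h3
  haveI : Finite (geomTorsion W (3 : ℤ)) := Nat.finite_of_card_ne_zero (by rw [hcard]; norm_num)
  haveI : Nontrivial (geomTorsion W (3 : ℤ)) := by
    rw [← Finite.one_lt_card_iff_nontrivial, hcard]; norm_num
  obtain ⟨T₀, hT₀⟩ := exists_ne (0 : geomTorsion W (3 : ℤ))
  have hT3 : (3 : ℤ) • (show (W.baseChange (AlgebraicClosure K)).toAffine.Point from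
      (T₀ : geomPoints W)) = 0 := (Submodule.mem_torsionBy_iff _ _).mp T₀.2
  obtain ⟨S, hS3, hS0, hS1, hS2⟩ := exists_basis_partner W hT3
  have hSmem : (show geomPoints W from S) ∈ geomTorsion W 3 :=
    (Submodule.mem_torsionBy_iff _ _).mpr hS3
  refine ⟨⟨_, hSmem⟩, T₀, fun h => hS0 (congrArg Subtype.val h), hT₀,
    fun h => hS1 (congrArg Subtype.val h), fun h => hS2 (congrArg Subtype.val h)⟩

omit [CharZero K] [W.IsElliptic] in
/-- A value with cube `1` is non-zero. [folklore] -/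
theorem ne_zero_of_pow_three_eq_one {x : AlgebraicClosure K} (h : x ^ 3 = 1) : x ≠ 0 := by
  rintro rfl; norm_num at h

omit [W.IsElliptic] in
/-- **SYMPLECTIC OR ANTI-SYMPLECTIC.** For elliptic curves `W, W′ / K` (`char K = 0`), Weil-type
pairings `e` on `E[3]` and `e′` on `E′[3]` (values with cube `1`, bilinear, alternating,
non-degenerate) and ANY additive isomorphism `θ : E′[3] ≃ E[3]`: either `e (θS) (θT) = e′ S T` for
all `S, T` (`θ` symplectic FOR `e, e′`) or `e (θS) (θT) = (e′ S T)⁻¹` for all `S, T` (`θ`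
anti-symplectic FOR `e, e′`); nothing is claimed about the divisor-theoretic Weil pairing.
[cite: SilvermanAEC2009, Prop. III.8.1] -/
theorem symplectic_or_antisymplectic (W' : WeierstrassCurve K) [W'.IsElliptic]
    {e : geomTorsion W 3 → geomTorsion W 3 → AlgebraicClosure K}
    {e' : geomTorsion W' 3 → geomTorsion W' 3 → AlgebraicClosure K}
    (he3 : ∀ S T, e S T ^ 3 = 1) (hel : ∀ S₁ S₂ T, e (S₁ + S₂) T = e S₁ T * e S₂ T)
    (her : ∀ S T₁ T₂, e S (T₁ + T₂) = e S T₁ * e S T₂) (healt : ∀ T, e T T = 1)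
    (hend : ∀ T, (∀ S, e S T = 1) → T = 0)
    (he'3 : ∀ S T, e' S T ^ 3 = 1) (he'l : ∀ S₁ S₂ T, e' (S₁ + S₂) T = e' S₁ T * e' S₂ T)
    (he'r : ∀ S T₁ T₂, e' S (T₁ + T₂) = e' S T₁ * e' S T₂) (he'alt : ∀ T, e' T T = 1)
    (he'nd : ∀ T, (∀ S, e' S T = 1) → T = 0)
    (θ : geomTorsion W' 3 ≃+ geomTorsion W 3) :
    (∀ S T, e (θ S) (θ T) = e' S T) ∨ (∀ S T, e (θ S) (θ T) = (e' S T)⁻¹) := by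
  obtain ⟨S₀, T₀, h₁, h₂, h₃, h₄⟩ := exists_geomTorsion_three_basis W'
  have hex := geomTorsion_three_eq_of_basis W' h₁ h₂ h₃ h₄
  -- the transported pairing `f S T := e (θ S) (θ T)`
  have hfl : ∀ S₁ S₂ T, e (θ (S₁ + S₂)) (θ T) = e (θ S₁) (θ T) * e (θ S₂) (θ T) :=
    fun S₁ S₂ T => by rw [map_add, hel]
  have hfr : ∀ S T₁ T₂, e (θ S) (θ (T₁ + T₂)) = e (θ S) (θ T₁) * e (θ S) (θ T₂) :=
    fun S T₁ T₂ => by rw [map_add, her]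
  have hfalt : ∀ T, e (θ T) (θ T) = 1 := fun T => healt (θ T)
  have hfne : ∀ S T, e (θ S) (θ T) ≠ 0 := fun S T => ne_zero_of_pow_three_eq_one (he3 _ _)
  have he'ne : ∀ S T, e' S T ≠ 0 := fun S T => ne_zero_of_pow_three_eq_one (he'3 _ _)
  have hfnd : ∀ T, (∀ S, e (θ S) (θ T) = 1) → T = 0 := by
    intro T hT
    have hθT : θ T = 0 := hend (θ T) fun S => by
      have := hT (θ.symm S); rwa [θ.apply_symm_apply] at this
    exact (AddEquiv.map_eq_zero_iff θ).mp hθT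
  -- both values at the basis are primitive cube roots of unity
  have hx1 : e' S₀ T₀ ≠ 1 := ne_one_at_basis he'l he'alt he'ne he'nd hex h₂
  have hy1 : e (θ S₀) (θ T₀) ≠ 1 :=
    ne_one_at_basis (g := fun S T => e (θ S) (θ T)) hfl hfalt hfne hfnd hex h₂
  have hxy := eq_or_eq_inv_of_cube_eq_one (he'3 S₀ T₀) hx1 (he3 _ _) hy1
  exact eq_or_eq_inv_of_basis (f := fun S T => e (θ S) (θ T)) (g := e') hfl hfr hfalt hfne
    he'l he'r he'alt he'ne hex hxy

end Torsion

end Summit.BirchSwinnertonDyer.Rank1Residual.GaloisImage.CubeRootPairing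

end
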